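import Summits.BirchSwinnertonDyer.Rank1Residual.X11b.KolyvaginReductionDatum
import Summits.BirchSwinnertonDyer.BirchSwinnertonDyer.Theorems.Rank1ResidualJetKolyvaginFrobeniusTorsion
import Summits.BirchSwinnertonDyer.Rank1Residual.JET.RingClassTransverseLocal
import HarnessLib

/-!
# McCallum's reduction datum at a ZHANG–Kolyvagin prime (congruences `p ∣ ℓ + 1`, `p ∣ a_ℓ` only, NO `Frob(ℓ) = Frob(∞)`):
# x11b3's `KolyvaginH44.exists_reductionDatum` RE-KEYED, image-free
# (cell `bsd-stepL`, seat `bsd-stepL-corner-p1` g9; `--supports stmt-BirchSwinnertonDyer-19947`; memo CORNER-G9 §5)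

WHY. x11b3's `exists_reductionDatum` (X11b/KolyvaginReductionDatum) — the reduction half of the datum `hdata` of the tree's
McCallum-Prop.-4.4 theorem — assumes Gross's (3.2) `FrobEqFrobInfty W K p ℓ` and uses it ONLY to get a ℚ-Frobenius at
`𝔓₀` with `gc² = 1` and `gc ≠ ±1` on `E[p]`. Both follow from the congruences `p ∣ ℓ + 1`, `p ∣ a_ℓ` (Zhang's index
`≥ 1`) by Cayley–Hamilton on `T_p E` — bsd-jet's bricks `JET.GlobalDuality.frob_smul_frob_smul_eq_self_of_dvd` ∕
`exists_frob_smul_ne_smul` (`tr = a_ℓ ≡ 0 ≢ ±2`, `p` odd). **`exists_reductionDatum_of_not_dvd_conductorNorm`**: the SAME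
conclusion VERBATIM with `FrobEqFrobInfty` replaced by `ℓ ∤ N_E` (good reduction at `(ℓ)`); proof = x11b3's with that block
swapped. With `Prop44.zsmul_kolyvaginClass_mem_selmerLocalKer_iff_of_le_kolyvaginIndex` (the re-keyed wrapper) this puts
x11b3's `h44` chain within reach of the corner's ZHANG-prime levels. HONEST FRAMING: one theorem (a re-keying); no
definition ∕ fact ∕ sorry; nothing about BSD; no stub closes; T7.
References: [McCallumLMS1991] Prop. 4.4 (proof); [GrossLMS1991] §3 (3.2)–(3.4), Prop. 6.2 (2); [Jetchev2008] §3.2;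
[SilvermanAEC2009] V.2.3.1, VII.2.1, VII.3.1(b), VII.4.1; [WZhang2014] Notations (xii).
-/

set_option autoImplicit false
set_option linter.dupNamespace false

noncomputable section

open scoped Classical Pointwise
open WeierstrassCurve Field NumberField IsDedekindDomain
open Literature.NumberTheory.EllipticCurves Literature.NumberTheory.GaloisRepresentations
open Rat.HeightOneSpectrum
open Summit.BirchSwinnertonDyer.Rank1Residual.X11b.KolyvaginH44

universe u

namespace Summit.BirchSwinnertonDyer.BirchSwinnertonDyer.Theorems.Prop44

variable {ℓ : ℕ} [hℓ : Fact ℓ.Prime] {W : WeierstrassCurve ℚ} [W.IsGloballyMinimal] [W.IsElliptic]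
  (hΔ : ¬ (ℓ : ℤ) ∣ minimalDiscriminantInt W)
variable {K : Type u} [Field K] [NumberField K]

include hΔ in
/-- **McCallum's reduction datum at a Zhang–Kolyvagin prime** — x11b3's `KolyvaginH44.exists_reductionDatum` with Gross's
(3.2) `FrobEqFrobInfty W K p ℓ` replaced by `ℓ ∤ N_E` (the congruences `p ∣ ℓ + 1`, `p ∣ a_ℓ` were already hypotheses);
conclusion VERBATIM. [cite: McCallumLMS1991, Prop. 4.4 (proof)] [cite: GrossLMS1991, §3 (3.3)–(3.4), Prop. 6.2 (2)]
[cite: Jetchev2008, §3.2 (arXiv p. 10)] -/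
theorem exists_reductionDatum_of_not_dvd_conductorNorm {p : ℕ} [hp : Fact p.Prime] (hp2 : p ≠ 2) (hpℓ : p ≠ ℓ)
    (hN : ¬ ℓ ∣ W.conductorNorm ℤ) (hpl : p ∣ ℓ + 1) (hpa : (p : ℤ) ∣ W.frobeniusTrace ℓ)
    {φ₀ : absoluteGaloisGroup (ZMod ℓ)} (hφ : ∀ x : AlgebraicClosure (ZMod ℓ), φ₀ • x = x ^ ℓ)
    {v : HeightOneSpectrum (𝓞 K)} (hv : (ℓ : 𝓞 K) ∈ v.asIdeal)
    (huniq : ∀ w : HeightOneSpectrum (𝓞 K), (ℓ : 𝓞 K) ∈ w.asIdeal → w = v)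
    (hres : v.residueCard = ℓ ^ 2)
    {𝔓 : Ideal (absIntegers (𝓞 K) K)} (h𝔓 : 𝔓 ∈ v.primesAbove)
    {n : ℕ} (hn : ¬ ℓ ∣ n) (hn0 : n ≠ 0) {F : absoluteGaloisGroup K}
    (hF : IsArithFrobAt (𝓞 K) F 𝔓) (hFfix : F ∈ torsionFixing (W.baseChange K) (n : ℤ)) :
    ∃ (g : absoluteGaloisGroup K)
      (red : geomPoints (W.baseChange K) →+ (reductionModPrime W ℓ).geomPoints)
      (φ : (reductionModPrime W ℓ).geomPoints →+ (reductionModPrime W ℓ).geomPoints),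
      (∀ x, red x = geomReduction hΔ ((RatClosure.pointsEquiv (K := K) W).symm (g⁻¹ • x))) ∧
      (∀ b, φ b = φ₀ • b) ∧
      (∀ τ ∈ 𝔓.inertia (absoluteGaloisGroup K), ∀ x, red (τ • x) = red x) ∧
      (∀ x, red (F • x) = φ (φ (red x))) ∧
      (∀ x, (n : ℤ) • x = 0 → red x = 0 → x = 0) ∧
      (∀ b, (n : ℤ) • b = 0 → φ (φ b) = b) ∧
      (∀ b, φ (φ b) = b → IsOfFinAddOrder b) ∧
      (∀ b, φ (φ b) = b → ((ℓ + 1 : ℕ) : ℤ) • b = W.frobeniusTrace ℓ • φ b) ∧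
      (∀ s : ℤ, s = 1 ∨ s = -1 → ∃ (g : (reductionModPrime W ℓ).geomPoints) (e : ℕ),
        φ g = s • g ∧ addOrderOf g = p ^ e ∧
        (p : ℤ) ^ e ∣ ((ℓ + 1 : ℕ) : ℤ) - s * W.frobeniusTrace ℓ ∧
        ¬ (p : ℤ) ^ (e + 1) ∣ ((ℓ + 1 : ℕ) : ℤ) - s * W.frobeniusTrace ℓ ∧
        ∀ c, φ c = s • c → (∃ k : ℕ, ((p : ℤ) ^ k) • c = 0) → ∃ i : ℤ, c = i • g) := by
  haveI : (reductionModPrime W ℓ).IsElliptic := isElliptic_reductionModPrime W hΔ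
  set θ := RatClosure.pointsEquiv (K := K) W with hθ
  -- the place `v₀ = (ℓ)` of `ℚ`, the prime `𝔓₀ = 𝔓 ∩ \bar ℤ`, the prime `𝔓pl` of the place
  obtain ⟨v₀, hv₀, hℓv₀⟩ := exists_ratPlace ℓ
  haveI := v.isPrime
  have hw : v.asIdeal.under (𝓞 ℚ) = v₀.asIdeal :=
    Rat.under_eq_asIdeal_of_natCast_mem hℓ.out hℓv₀ hv
  set 𝔓₀ : Ideal (absIntegers (𝓞 ℚ) ℚ) := 𝔓.comap (absIntegersMap ℚ K) with h𝔓₀def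
  have h𝔓₀ : 𝔓₀ ∈ v₀.primesAbove := comap_absIntegersMap_mem_primesAbove hw h𝔓
  obtain ⟨𝔓pl, hmem, h𝔓pl⟩ := exists_ideal_placeOver ℓ hv₀
  -- a `g ∈ Γ_K` with `res g • 𝔓pl = 𝔓₀` (transitivity of `Γ_K` on the primes above the inert `λ`)
  obtain ⟨𝔔, w, h𝔔c, hwv₀, h𝔔w⟩ := exists_place_comap_eq_smul (M := K) h𝔓pl 1
  rw [one_smul] at h𝔔c
  have hwv : w = v := by
    refine huniq w ?_
    haveI := w.isPrime
    have : (ℓ : 𝓞 ℚ) ∈ w.asIdeal.under (𝓞 ℚ) := by rw [hwv₀]; exact hℓv₀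
    rw [Ideal.under_def, Ideal.mem_comap, map_natCast] at this
    exact this
  subst hwv
  obtain ⟨g, hg⟩ := HeightOneSpectrum.exists_smul_eq_of_mem_primesAbove_holds h𝔔w h𝔓
  have hδ : absGaloisRestrict ℚ K g • 𝔓pl = 𝔓₀ := by
    rw [← h𝔔c, ← comap_absIntegersMap_smul, hg]
  -- the reduction along `𝔓₀`
  obtain ⟨hI, hFr, hinj, -⟩ := geomReduction_conj_datum hΔ hv₀ hmem h𝔓pl hδ hφ
  set red₀ : W.geomPoints →+ (reductionModPrime W ℓ).geomPoints :=
    (geomReduction hΔ).comp (DistribSMul.toAddMonoidHom W.geomPoints (absGaloisRestrict ℚ K g)⁻¹)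
    with hred₀def
  have hred₀ : ∀ P, red₀ P = geomReduction hΔ ((absGaloisRestrict ℚ K g)⁻¹ • P) := fun P ↦ rfl
  set red : geomPoints (W.baseChange K) →+ (reductionModPrime W ℓ).geomPoints :=
    red₀.comp θ.symm.toAddMonoidHom with hreddef
  have hred : ∀ Q, red Q = red₀ (θ.symm Q) := fun Q ↦ rfl
  set Φ : (reductionModPrime W ℓ).geomPoints →+ (reductionModPrime W ℓ).geomPoints :=
    DistribSMul.toAddMonoidHom _ φ₀ with hΦdef
  have hΦ : ∀ b, Φ b = φ₀ • b := fun b ↦ rfl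
  -- ### `red ∘ F = φ² ∘ red`
  have hredF : ∀ x, red (F • x) = Φ (Φ (red x)) := by
    have hF' : ∀ x : absIntegers (𝓞 ℚ) ℚ,
        absGaloisRestrict ℚ K F • x - x ^ (ℓ ^ 2) ∈ 𝔓₀ := by
      rw [forall_smul_sub_pow_mem_comap_iff ℚ K 𝔓 F (ℓ ^ 2), ← hres]
      exact (HeightOneSpectrum.isArithFrobAt_iff_of_mem_primesAbove h𝔓 F).mp hF
    obtain ⟨h', hh'⟩ := HeightOneSpectrum.exists_isArithFrobAt_of_mem_primesAbove_holds h𝔓₀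
    have hq : v₀.residueCard = ℓ := by
      rw [Rat.residueCard_eq_natGenerator]; exact hv₀
    have hpow : ∀ x : absIntegers (𝓞 ℚ) ℚ, h' ^ 2 • x - x ^ (ℓ ^ 2) ∈ 𝔓₀ := fun x ↦ by
      have := smul_pow_sub_pow_mem_of_isArithFrobAt h𝔓₀ hh' 2 x
      rwa [hq] at this
    set ι : absoluteGaloisGroup ℚ := absGaloisRestrict ℚ K F * (h' ^ 2)⁻¹ with hι
    have hιI : ι ∈ 𝔓₀.inertia (absoluteGaloisGroup ℚ) := by
      intro x
      change ι • x - x ∈ 𝔓₀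
      set y := (h' ^ 2)⁻¹ • x with hy
      have hx : x = h' ^ 2 • y := by rw [hy, smul_inv_smul]
      have h1 : ι • x = absGaloisRestrict ℚ K F • y := by rw [hι, mul_smul]
      rw [h1, hx]
      have := sub_mem (hF' y) (hpow y)
      rwa [sub_sub_sub_cancel_right] at this
    have hιh : ι * h' ^ 2 = absGaloisRestrict ℚ K F := by
      rw [hι, mul_assoc, inv_mul_cancel, mul_one]
    intro x
    rw [hred, hred, pointsEquiv_symm_smul, ← hιh, mul_smul, hI ι hιI, pow_two, mul_smul,
      hFr h' hh', hFr h' hh', hΦ, hΦ]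
  -- ### a ℚ-Frobenius `gc` at `𝔓₀`: `gc² = 1` and `gc ≠ ±1` on `E[p]` FROM THE CONGRUENCES (bsd-jet bricks B;
  -- Cayley–Hamilton on `T_p E`, `tr = a_ℓ ≡ 0`, `det = ℓ ≡ −1`), replacing Gross's (3.2) `Frob(ℓ) = c₀` of the original
  obtain ⟨gc, hgc⟩ := HeightOneSpectrum.exists_isArithFrobAt_of_mem_primesAbove_holds h𝔓₀
  have hFrP : IsArithFrobAtPlace ℚ v₀ gc := ⟨𝔓₀, h𝔓₀, hgc⟩
  have hne : ((primesEquiv v₀ : Nat.Primes) : ℕ) ≠ p := by rw [hv₀]; exact hpℓ.symm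
  have hgoodv₀ : W.HasGoodReductionAt v₀ :=
    Summit.BirchSwinnertonDyer.Rank1Residual.X11b.Three.Koly.Method2.LocalFrob.hasGoodReductionAt_rat_of_not_dvd_conductorNorm
      W hℓ.out hN v₀ hℓv₀
  have h1' : p ^ 1 ∣ ((primesEquiv v₀ : Nat.Primes) : ℕ) + 1 := by rw [hv₀, pow_one]; exact hpl
  have ha' : ((p ^ 1 : ℕ) : ℤ) ∣ W.frobeniusTrace ((primesEquiv v₀ : Nat.Primes) : ℕ) := by
    rw [hv₀, pow_one]; exact hpa
  have ha'' : (p : ℤ) ∣ W.frobeniusTrace ((primesEquiv v₀ : Nat.Primes) : ℕ) := by rw [hv₀]; exact hpa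
  have hgg : ∀ P : W.geomPoints, (p : ℤ) • P = 0 → gc • gc • P = P := by
    intro P hP
    have hPmem : P ∈ geomTorsion W ((p ^ 1 : ℕ) : ℤ) := by
      rw [mem_geomTorsion_iff, pow_one]; exact hP
    exact congrArg Subtype.val
      (Summit.BirchSwinnertonDyer.Rank1Residual.JET.GlobalDuality.frob_smul_frob_smul_eq_self_of_dvd W p hne
        hgoodv₀ h1' ha' hFrP ⟨P, hPmem⟩)
  have hinv : ∀ b : (reductionModPrime W ℓ).geomPoints, (p : ℤ) • b = 0 → φ₀ • φ₀ • b = b := by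
    intro b hb
    obtain ⟨P, hP, rfl⟩ := exists_torsion_lift W hΔ hinj (hpℓ.symm ∘ fun h ↦
      ((Nat.prime_dvd_prime_iff_eq hℓ.out hp.out).mp h)) hp.out.ne_zero b hb
    rw [← hFr gc hgc, ← hFr gc hgc, hgg P hP]
  have hns : ∀ s : ℤ, s = 1 ∨ s = -1 →
      ¬ ∀ b : (reductionModPrime W ℓ).geomPoints, (p : ℤ) • b = 0 → φ₀ • b = s • b := by
    intro s hs hall
    obtain ⟨Q, hQ⟩ :=
      Summit.BirchSwinnertonDyer.Rank1Residual.JET.GlobalDuality.exists_frob_smul_ne_smul W p hp2 hne hgoodv₀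
        ha'' hFrP hs
    apply hQ
    apply Subtype.ext
    have hQp : (p : ℤ) • (Q : W.geomPoints) = 0 := (mem_geomTorsion_iff W p _).mp Q.2
    have hred0 : red₀ (gc • (Q : W.geomPoints) - s • (Q : W.geomPoints)) = 0 := by
      rw [map_sub, hFr gc hgc, map_zsmul, hall _ (by rw [← map_zsmul, hQp, map_zero]), sub_self]
    have htor : p • (gc • (Q : W.geomPoints) - s • (Q : W.geomPoints)) = 0 := by
      rw [← natCast_zsmul, smul_sub, smul_comm, hQp, smul_zero, zero_sub, neg_eq_zero, smul_comm,
        hQp, smul_zero]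
    have hgP := sub_eq_zero.mp (hinj p (hpℓ.symm ∘ fun h ↦
      ((Nat.prime_dvd_prime_iff_eq hℓ.out hp.out).mp h)) _ htor hred0)
    simpa only [Literature.NumberTheory.EllipticCurves.AddSubgroup.torsionBy.coe_smul,
      AddSubgroupClass.coe_zsmul] using hgP
  -- ### the finite-field datum
  have ha : W.frobeniusTrace ℓ = (ℓ : ℤ) + 1 - Nat.card (reductionModPrime W ℓ).toAffine.Point :=
    frobeniusTrace_eq_sub_natCard_reductionModPrime W ℓ
  obtain ⟨htors, hchar, hcyc⟩ :=
    frobenius_eigen_datum (reductionModPrime W ℓ) hφ hp2 hpℓ ha hpl hpa hinv hns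
  refine ⟨g, red, Φ, fun x ↦ ?_, fun b ↦ rfl, ?_, hredF, ?_, ?_, fun b hb ↦ htors b hb,
    fun b hb ↦ hchar b hb, ?_⟩
  · rw [hred, hred₀, pointsEquiv_symm_smul, map_inv]
  · -- inertia
    intro τ hτ x
    rw [hred, hred, pointsEquiv_symm_smul]
    exact hI _ (absGaloisRestrict_mem_inertia_comap ℚ K hτ) _
  · -- injective on `E[n]`
    intro x hx h0
    rw [hred] at h0
    have hx' : n • θ.symm x = 0 := by rw [← natCast_zsmul, ← map_zsmul, hx, map_zero]
    have := hinj n hn _ hx' h0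
    rw [← θ.symm.map_eq_zero_iff]
    exact this
  · -- `φ² = 1` on `B[n]`
    intro b hb
    obtain ⟨P₀, hP₀, rfl⟩ := exists_torsion_lift W hΔ hinj hn hn0 b hb
    set Q : geomPoints (W.baseChange K) := θ P₀ with hQdef
    have hQn : Q ∈ geomTorsion (W.baseChange K) (n : ℤ) := by
      rw [mem_geomTorsion_iff, hQdef, ← map_zsmul, hP₀, map_zero]
    have hFQ : F • Q = Q :=
      congrArg Subtype.val (((mem_torsionFixing_iff (W.baseChange K) (n : ℤ)).mp hFfix) ⟨Q, hQn⟩)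
    have hQred : red Q = red₀ P₀ := by rw [hred, hQdef, AddEquiv.symm_apply_apply]
    rw [← hQred, ← hredF, hFQ]
  · intro s hs
    obtain ⟨g₁, e, hg₁, hord, hdvd, hndvd, hgen⟩ := hcyc s hs
    exact ⟨g₁, e, hg₁, hord, hdvd, hndvd, hgen⟩


end Summit.BirchSwinnertonDyer.BirchSwinnertonDyer.Theorems.Prop44

end
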